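import Summits.HodgeConjecture.CorCM.GaloisSixteenClassification
import Literature.NumberTheory.ComplexMultiplication.DegenerateOcticCMTypesSexticReflex
import Literature.AlgebraicGeometry.ComplexMultiplication.EndomorphismFieldNondegenerateType
import Literature.NumberTheory.ComplexMultiplication.ShimuraTaniyamaHecke
import Summits.HodgeConjecture.HodgeConjecture.Theorems.Ring2ClassTargets
import HarnessLib

/-!
# Galois CM fields of degree `16`: EVERY NON-simple abelian eightfold with a `K`-action is stably nondegenerate, and
# ALL abelian varieties with CM by `K` are stably nondegenerate iff `GOOD16(Gal, c)`

COR-CM (cell `pub-hodgecm2`), binder seat b04 (gen 21), count-neutral claim SIXTEEN-ALLTYPES — the all-types upgrade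
of gen 17's `(Gal, c)`-classification of the Galois CM fields of degree `16` (`GaloisSixteenClassification.forall_
isPrimitive_isNondegenerate_iff_good16`: every primitive CM type nondegenerate ⟺ (all squares in `{1, c}`) ∨ (an
element `r` of order `8` with `r⁴ = c` and `g r g⁻¹ ∈ {r, r⁻¹}` for all `g`)).  KERNEL ONLY: theorems; no definition,
no named fact, no `sorry`.  `HC_CM` is neither used nor claimed.

The new input is Dodson's §3.3.2 in the tree (lit `DegenerateOcticCMTypesSexticReflex.three_dvd_card_gal_of_not_
isNondegenerate`: a DEGENERATE primitive octic CM type of a CM field `K₁` embedded in a Galois CM field `L` forces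
`3 ∣ |Gal(L/ℚ)|`): so EVERY octic CM subfield of a Galois CM field of degree prime to `3` is GOOD — Galois or not,
whatever its automorphisms (`isNondegenerate_of_isPrimitive_octic_of_not_three_dvd`).  With lit-hodgefound's
primitive core (`EndFieldFullDegree.exists_primitive_core`): a NON-simple abelian eightfold `X` with `K ↪ End⁰(X)`,
`[K:ℚ] = 16`, is `∼ B₁ʰ` with `B₁` simple CM of dimension `1, 2` (Ribet) or `4` (CM by an octic subfield of `K`:
GOOD), hence stably nondegenerate — for EVERY Galois group of order `16` (§1).  Therefore ALL-X(K) ⟺ GOOD(K) ⟺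
GOOD16 (§2), completing the degree-`16` row of the classification for all abelian varieties.

* §1 `isNondegenerate_of_isPrimitive_octic_of_not_three_dvd`, **`isStablyNondegenerate_of_not_isSimple_sixteen`**.
* §2 **`isStablyNondegenerate_of_good16`**, **`forall_isStablyNondegenerate_iff_good16`**, realisation form,
  `HCOnClass` display.

## References

* [Dodson1984] B. Dodson, *The structure of Galois groups of CM-fields*, Trans. AMS 283 (1984), §3.3.2 Theorem (p. 16),
  §5 (groups of order `16`).
* [Ribet1980] K. A. Ribet, Mém. SMF 2 (1980), §3 Examples (3.7).
* [Shimura1998] G. Shimura, *Abelian Varieties with Complex Multiplication and Modular Functions* (1998), §5.1 Prop. 3,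
  §8.2 Prop. 26.
* [Gordon1999HodgeAVSurvey] B. B. Gordon, *A survey of the Hodge conjecture for abelian varieties*, Thm. 6.4, Def. 7.6.
-/

noncomputable section

open CategoryTheory CategoryTheory.Limits NumberField

namespace Summit.HodgeConjecture.CorCM.GaloisSixteenAllTypes

open Literature.NumberTheory.ComplexMultiplication
open Literature.AlgebraicGeometry Literature.AlgebraicGeometry.Motives Literature.AlgebraicGeometry.HodgeTheory
open Literature.AlgebraicGeometry.Motives.AbelianVariety
open Literature.AlgebraicGeometry.ComplexMultiplication
open Literature.AlgebraicGeometry.Pohlmann1968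
open Summit.HodgeConjecture.HodgeConjecture.Ring2.ClassTargets
open Summit.HodgeConjecture.CorCM.GaloisSixteenClassification (forall_isPrimitive_isNondegenerate_iff_good16
  isNondegenerate_of_isPrimitive_of_good16)

variable {K : Type} [Field K] [NumberField K] [IsCMField K] [IsGalois ℚ K]

/-! ## §1 Octic CM subfields of a Galois CM field of degree prime to `3` are GOOD; non-simple eightfolds -/

/-- **Octic CM fields embedded in a Galois CM field of degree prime to `3` are GOOD** (no Galois or automorphism
hypothesis on the octic field): a degenerate primitive octic type would force `3 ∣ |Gal(K/ℚ)|` (Dodson §3.3.2, tree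
`three_dvd_card_gal_of_not_isNondegenerate`). [cite: Dodson1984, §3.3.2 Theorem (p. 16)] -/
theorem isNondegenerate_of_isPrimitive_octic_of_not_three_dvd {K₁ : Type} [Field K₁] [NumberField K₁] [IsCMField K₁]
    (h8 : Module.finrank ℚ K₁ = 8) (j : K₁ →ₐ[ℚ] K) (h3 : ¬ 3 ∣ Module.finrank ℚ K) (Φ₁ : CMType K₁)
    (φ₁ : K₁ →+* ℂ) (hprim : IsPrimitive (ℂ ≃+* ℂ) Φ₁.1 φ₁) : IsNondegenerate Φ₁ := by
  by_contra hdeg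
  obtain ⟨ι⟩ := (inferInstance : Nonempty (K →+* ℂ))
  have h := three_dvd_card_gal_of_not_isNondegenerate h8 j ι Φ₁ φ₁ hprim hdeg
  rw [IsGalois.card_aut_eq_finrank] at h
  exact h3 h

/-- **THEOREM (non-simple eightfolds, ANY Galois group of order `16`).**  `K` Galois CM of degree `16`: every
NON-simple complex abelian variety `X` with `φ : K →+* End⁰(X)`, `[K:ℚ] = 2 dim X`, is STABLY NONDEGENERATE — it is
isogenous to `B₁ʰ`, `h ≥ 2`, with `B₁` the simple variety of the primitive core `(K₁; Φ₁)` of THE type, `K₁ ≤ K` a CM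
subfield of degree `2`, `4` (Ribet) or `8` (GOOD by Dodson, `3 ∤ 16`). UNCONDITIONAL.
[cite: Dodson1984, §3.3.2 Theorem (p. 16)] [cite: Ribet1980, §3 Examples (3.7)] [cite: Shimura1998, §5.1 Prop. 3, §8.2 Prop. 26] -/
theorem isStablyNondegenerate_of_not_isSimple_sixteen (h16 : Module.finrank ℚ K = 16) {X : AbelianVariety ℂ}
    (φ : K →+* X.endAlgebra) (hX : Module.finrank ℚ K = 2 * X.dim) (hns : ¬ X.IsSimple) :
    IsStablyNondegenerate X := by
  obtain ⟨K', hK', K₁, hK₁, Φ₁, hprim, hdim, hB₁, -, hS, hsimple⟩ := EndFieldFullDegree.exists_primitive_core φ hX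
  haveI := hK'
  haveI := hK₁
  apply hS
  set d : ℕ := (CMTorusRealisation.varietyOfIdeal Φ₁ 1).dim with hd_def
  have hXd : X.dim = 8 := by omega
  have hdvd : d ∣ 8 := ⟨Module.finrank K' K * Module.finrank K₁ K', by rw [← hXd, hdim]; ring⟩
  have hlt : d < 8 := lt_of_le_of_ne (Nat.le_of_dvd (by norm_num) hdvd) fun h => hns (hsimple (by rw [hXd, h]))
  obtain ⟨φ₁⟩ := (inferInstance : Nonempty (K₁ →+* ℂ))
  have hprim₁ := (isPrimitive_ringEquiv_complex_iff Φ₁ φ₁).2 hprim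
  have hd4 : d ≤ 4 := by
    obtain ⟨k, hk⟩ := hdvd
    have hk2 : 2 ≤ k := by
      by_contra h
      push Not at h
      interval_cases k <;> omega
    have h2 : d * 2 ≤ d * k := Nat.mul_le_mul_left d hk2
    omega
  rcases Nat.lt_or_ge d 4 with hd3 | hd4'
  · -- `[K₁:ℚ] ≤ 6`: Ribet
    exact CMTorusRealisation.isStablyNondegenerate_varietyOfIdeal Φ₁ 1
      (Pohlmann1968.isNondegenerate_of_isPrimitive_of_finrank_le_six (Φ := Φ₁) (by omega) φ₁ hprim₁)
  · -- `[K₁:ℚ] = 8`: Dodson, `3 ∤ 16`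
    have h8 : Module.finrank ℚ K₁ = 8 := by omega
    exact CMTorusRealisation.isStablyNondegenerate_varietyOfIdeal Φ₁ 1
      (isNondegenerate_of_isPrimitive_octic_of_not_three_dvd h8 ((K'.val).comp K₁.val) (by rw [h16]; decide)
        Φ₁ φ₁ hprim₁)

/-! ## §2 ALL abelian varieties: stably nondegenerate iff GOOD16 -/

/-- **THEOREM.**  `K` Galois CM of degree `16` with GOOD16 (every primitive CM type nondegenerate; gen 17): EVERY complex
abelian variety `X` with `φ : K →+* End⁰(X)`, `[K:ℚ] = 2 dim X` — simple or not — is stably nondegenerate. UNCONDITIONAL.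
[cite: Dodson1984, §3.3.2 and §5] [cite: Gordon1999HodgeAVSurvey, Thm. 6.4 and Def. 7.6] -/
theorem isStablyNondegenerate_of_good16 (h16 : Module.finrank ℚ K = 16)
    (hgood : (∀ g : K ≃ₐ[ℚ] K, g * g = 1 ∨ g * g = (IsCMField.complexConj K).restrictScalars ℚ) ∨
      (∃ r : K ≃ₐ[ℚ] K, orderOf r = 8 ∧ r ^ 4 = (IsCMField.complexConj K).restrictScalars ℚ ∧
        ∀ g : K ≃ₐ[ℚ] K, g * r * g⁻¹ = r ∨ g * r * g⁻¹ = r⁻¹))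
    {X : AbelianVariety ℂ} (φ : K →+* X.endAlgebra) (hX : Module.finrank ℚ K = 2 * X.dim) :
    IsStablyNondegenerate X := by
  by_cases hs : X.IsSimple
  · obtain ⟨φ₀⟩ := (inferInstance : Nonempty (K →+* ℂ))
    have hprim := (isPrimitive_ringEquiv_complex_iff _ φ₀).2
      ((EndFieldFullDegree.isSimple_iff_primitive_cmTypeOfPair φ hX).1 hs)
    exact EndFieldFullDegree.isStablyNondegenerate_of_isNondegenerate_cmTypeOfPair φ hX
      (isNondegenerate_of_isPrimitive_of_good16 h16 hgood φ₀ hprim)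
  · exact isStablyNondegenerate_of_not_isSimple_sixteen h16 φ hX hs

/-- **THE CLASSIFICATION (degree `16`, all abelian varieties).**  `K` Galois CM of degree `16`: EVERY complex abelian
variety with `K ↪ End⁰(X)`, `[K:ℚ] = 2 dim X`, is stably nondegenerate ⟺ GOOD16(`Gal(K/ℚ)`, `c`) — the same condition
as for SIMPLE eightfolds (gen 17). [cite: Dodson1984, §3.3.2 and §5] [cite: Gordon1999HodgeAVSurvey, Thm. 6.4]
[cite: Shimura1998, §6.2 Thm. 3 and §8.2 Prop. 26] -/
theorem forall_isStablyNondegenerate_iff_good16 (h16 : Module.finrank ℚ K = 16) :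
    (∀ (X : AbelianVariety ℂ) (_ : K →+* X.endAlgebra), Module.finrank ℚ K = 2 * X.dim → IsStablyNondegenerate X) ↔
      ((∀ g : K ≃ₐ[ℚ] K, g * g = 1 ∨ g * g = (IsCMField.complexConj K).restrictScalars ℚ) ∨
        (∃ r : K ≃ₐ[ℚ] K, orderOf r = 8 ∧ r ^ 4 = (IsCMField.complexConj K).restrictScalars ℚ ∧
          ∀ g : K ≃ₐ[ℚ] K, g * r * g⁻¹ = r ∨ g * r * g⁻¹ = r⁻¹)) := by
  refine ⟨fun h => ?_, fun hgood X φ hX => isStablyNondegenerate_of_good16 h16 hgood φ hX⟩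
  obtain ⟨φ₀⟩ := (inferInstance : Nonempty (K →+* ℂ))
  rw [← forall_isPrimitive_isNondegenerate_iff_good16 h16 φ₀]
  intro Ψ hprim
  obtain ⟨B, ιB, θB, hB⟩ := exists_isCMTypeRealisation_of_realised
    Summit.HodgeConjecture.CorCM.cmAbelianVarietyRealised_holds K Ψ
  obtain ⟨i, -⟩ := exists_ringHom_endAlgebra ιB
  exact (isStablyNondegenerate_iff_isNondegenerate φ₀ hprim hB).1
    (h B i (finrank_eq_two_mul_dim_of_isCMTypeRealisation hB))

/-- **Unconditionally, for EVERY Galois CM field of degree `16`**: all NON-simple abelian varieties with a `K`-action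
satisfy the Hodge conjecture with all their powers (§1), so the Hodge question for CM by `K` lives on the simple
eightfolds alone. [cite: Dodson1984, §3.3.2 Theorem (p. 16)] [cite: Gordon1999HodgeAVSurvey, Thm. 6.4] -/
theorem hodgeConjectureFor_powSucc_of_not_isSimple_sixteen (h16 : Module.finrank ℚ K = 16) {X : AbelianVariety ℂ}
    (φ : K →+* X.endAlgebra) (hX : Module.finrank ℚ K = 2 * X.dim) (hns : ¬ X.IsSimple) (N : ℕ) :
    HodgeConjectureFor (X.powSucc N).dim (X.powSucc N).X :=
  (isStablyNondegenerate_of_not_isSimple_sixteen h16 φ hX hns).hodgeConjectureFor_powSucc N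

variable {Φ : CMType K} {A : AbelianVariety ℂ} {ι : 𝓞 K →+* End A} {θ : K →+* Module.End ℂ (complexBetti A.X 1)}

/-- **Realisation form**: GOOD16 ⟹ every abelian variety `(A, ι)` of ANY CM type `(K; Φ)` satisfies the Hodge conjecture
with all its powers (gen 17's `hodgeConjectureFor_pow_of_isSimple_of_good16` without `A.IsSimple`).
[cite: Gordon1999HodgeAVSurvey, Thm. 6.4] -/
theorem hodgeConjectureFor_pow_of_good16 (h16 : Module.finrank ℚ K = 16)
    (hgood : (∀ g : K ≃ₐ[ℚ] K, g * g = 1 ∨ g * g = (IsCMField.complexConj K).restrictScalars ℚ) ∨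
      (∃ r : K ≃ₐ[ℚ] K, orderOf r = 8 ∧ r ^ 4 = (IsCMField.complexConj K).restrictScalars ℚ ∧
        ∀ g : K ≃ₐ[ℚ] K, g * r * g⁻¹ = r ∨ g * r * g⁻¹ = r⁻¹))
    (hA : IsCMTypeRealisation Φ A ι θ) (N : ℕ) :
    HodgeConjectureFor (⨁ fun _ : Fin N => A).dim (⨁ fun _ : Fin N => A).X := by
  obtain ⟨i, -⟩ := exists_ringHom_endAlgebra ι
  exact hodgeConjectureFor_of_isDivisorGenerated _
    ((isStablyNondegenerate_iff_forall_isDivisorGenerated_biproduct A).1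
      (isStablyNondegenerate_of_good16 h16 hgood i (finrank_eq_two_mul_dim_of_isCMTypeRealisation hA)) N)

/-- **HC on the class «isogenous to a power of an abelian eightfold `X` with an action of a Galois CM field of degree
`16` satisfying GOOD16»** — UNCONDITIONAL, no simplicity. [cite: Gordon1999HodgeAVSurvey, Thm. 6.3–6.4] -/
theorem hcOnClass_isIsogenous_powSucc_galoisCM_good16 :
    HCOnClass fun B ↦ ∃ (X : AbelianVariety ℂ) (N : ℕ) (K : Type) (_ : Field K) (_ : NumberField K)
      (_ : IsCMField K) (_ : IsGalois ℚ K),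
      Module.finrank ℚ K = 16 ∧
      ((∀ g : K ≃ₐ[ℚ] K, g * g = 1 ∨ g * g = (IsCMField.complexConj K).restrictScalars ℚ) ∨
        (∃ r : K ≃ₐ[ℚ] K, orderOf r = 8 ∧ r ^ 4 = (IsCMField.complexConj K).restrictScalars ℚ ∧
          ∀ g : K ≃ₐ[ℚ] K, g * r * g⁻¹ = r ∨ g * r * g⁻¹ = r⁻¹)) ∧
      Module.finrank ℚ K = 2 * X.dim ∧ Nonempty (K →+* X.endAlgebra) ∧ IsIsogenous B (X.powSucc N) := by
  rintro B ⟨X, N, K, _, _, _, _, h16, hgood, hX, ⟨φ⟩, h⟩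
  exact (isStablyNondegenerate_of_good16 h16 hgood φ hX).hodgeConjectureFor_of_isIsogenous_powSucc h

end Summit.HodgeConjecture.CorCM.GaloisSixteenAllTypes

end
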